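import Summits.KontsevichZagierPeriods.KontsevichZagierPeriods.Theorems.RootDecompQuadraticDescentPair18HomotopyP04

/-! # `RootDecompQuadraticDescentPair18HomotopyP05` — part 5/31 of the mechanical ≤400-line split of `Pair18Homotopy_v14_noguard.lean` (sha256 72e9c8442b4af820…)
Source: decomp-kz lens-6 g9 `Pair18Homotopy.lean` v14 (HOME/decomp-kz-lens-6/g9/, sha256 3dda3232…; critic g4-48/g4-53/g4-56/g5 CLEARED; census pair #18 of crux stmt-KontsevichZagierPeriods-28994: homotopy cells, duplications, inversions, Euler–Landen, arc/angle regions; terminal `pair18_g8strips_of_grid : hEuler → hGrid → hAng4 → (g8 form of #18)`); `#guard_msgs … #print axioms` pins removed for landing.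
Split by census-1 g9 `gen/splitlean.py`: scopes re-opened with their `open`/`variable`/`set_option` context; mathematics and declaration order unchanged. -/

set_option linter.unusedSimpArgs false
noncomputable section
open _root_.Set MvPolynomial
namespace Summit.KontsevichZagierPeriods.RootDecompQuadraticDescent.Pair18Homotopy
open Literature.NumberTheory.Transcendental
open Literature.NumberTheory.Transcendental.KZ (RFun cube)
open Summit.KontsevichZagierPeriods.RootDecompQuadraticDescent.DarkPairs (rel_reflect_rep rel_double)
/-- Auxiliary step `ins1_0` (§0): ins1 0. [bookkeeping] -/
private theorem ins1_0 (c : ℝ) (x : Fin 2 → ℝ) : (Fin.insertNth (1 : Fin 3) c x : Fin 3 → ℝ) 0 = x 0 := rfl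

/-- Auxiliary step `ins2_0` (§0): ins2 0. [bookkeeping] -/
private theorem ins2_0 (c : ℝ) (x : Fin 2 → ℝ) : (Fin.insertNth (2 : Fin 3) c x : Fin 3 → ℝ) 0 = x 0 := rfl

/-- Auxiliary step `ins1_1` (§0): ins1 1. [bookkeeping] -/
private theorem ins1_1 (c : ℝ) (x : Fin 2 → ℝ) : (Fin.insertNth (1 : Fin 3) c x : Fin 3 → ℝ) 1 = c := by simp

/-- Auxiliary step `ins2_1` (§0): ins2 1. [bookkeeping] -/
private theorem ins2_1 (c : ℝ) (x : Fin 2 → ℝ) : (Fin.insertNth (2 : Fin 3) c x : Fin 3 → ℝ) 1 = x 1 := rfl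

/-- Linearity in the integrand (rule 1b): `T = S + U` pointwise on the square. -/
private theorem rel_lin (T S U : RFun 2) (h : ∀ x ∈ cube 2, T.fn x = S.fn x + U.fn x) :
    KZ.of T.rep - KZ.of S.rep - KZ.of U.rep ∈ KZ.relations :=
  KZ.cubicalLinGens_subset_relations (KZ.mem_cubicalLinGens T.isTameCube_rep S.isTameCube_rep
    U.isTameCube_rep fun x hx => by simpa using h x hx)

/-- Auxiliary step `ins2_2` (§0): ins2 2. [bookkeeping] -/
private theorem ins2_2 (c : ℝ) (x : Fin 2 → ℝ) : (Fin.insertNth (2 : Fin 3) c x : Fin 3 → ℝ) 2 = c := by simp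

/-- Auxiliary step `ins1_2` (§0): ins1 2. [bookkeeping] -/
private theorem ins1_2 (c : ℝ) (x : Fin 2 → ℝ) : (Fin.insertNth (1 : Fin 3) c x : Fin 3 → ℝ) 2 = x 1 := rfl

namespace CellC8

/-- Auxiliary step `cert`: cert. [bookkeeping] -/
theorem cert (x : Fin 3 → ℝ) (hx : x ∈ KZ.cube 3) : (P.pd 2).fn x = (Q.pd 1).fn x := by
  have hD := (D_pos hx).ne'
  simp +decide only [RFun.fn, RFun.pd, map_add, map_sub, map_mul, map_pow, map_zero, map_neg,
      aeval_C, aeval_X, map_one, eq_ratCast, Rat.cast_one, Rat.cast_ofNat, Rat.cast_div, Rat.cast_neg,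
      Derivation.leibniz, pderiv_C, pderiv_X, Pi.single_apply,
      smul_eq_mul, Derivation.map_one_eq_zero, if_true, if_false, mul_one, mul_zero, zero_mul, add_zero,
      zero_add, sub_zero, zero_sub, one_mul, P, Q, D] at hD ⊢
  rw [div_eq_div_iff (pow_ne_zero 2 hD) (pow_ne_zero 2 hD)]
  ring

/-- Auxiliary step `tel`: tel. [bookkeeping] -/
theorem tel : bd 2 P - bd 1 Q ∈ KZ.relations := telescope₁ 2 1 P Q cert

/-- Auxiliary step `top`: top. [bookkeeping] -/
theorem top : KZ.of (P.faceAt 2 1 ⟨zero_le_one, le_rfl⟩).rep - KZ.of N4.rep ∈ KZ.relations :=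
  RFun.rel_of_eqOn fun x _ => by
    rw [RFun.fn_faceAt]
    simp only [RFun.fn, map_add, map_sub, map_mul, map_pow, map_neg, aeval_C, aeval_X, map_one, map_ofNat,
      eq_ratCast, Rat.cast_one, Rat.cast_ofNat, Rat.cast_div, Rat.cast_neg, Rat.cast_zero, ins1_0, ins1_1, ins1_2,
      ins2_0, ins2_1, ins2_2, P, D, N4, N4Den, Nat.cast_ofNat]
    try ring

/-- Auxiliary step `bot`: bot. [bookkeeping] -/
theorem bot : KZ.of (P.faceAt 2 0 ⟨le_rfl, zero_le_one⟩).rep - KZ.of C8Bot.rep ∈ KZ.relations :=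
  RFun.rel_of_eqOn fun x _ => by
    rw [RFun.fn_faceAt]
    simp only [RFun.fn, map_add, map_sub, map_mul, map_pow, map_neg, aeval_C, aeval_X, map_one, map_ofNat,
      eq_ratCast, Rat.cast_one, Rat.cast_ofNat, Rat.cast_div, Rat.cast_neg, Rat.cast_zero, ins1_0, ins1_1, ins1_2,
      ins2_0, ins2_1, ins2_2, P, D, C8Bot, C8BotDen, Nat.cast_ofNat]
    try ring

/-- Auxiliary step `right`: right. [bookkeeping] -/
theorem right : KZ.of (Q.faceAt 1 1 ⟨zero_le_one, le_rfl⟩).rep ∈ KZ.relations :=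
  RFun.rel_of_eqOn_zero fun x _ => by
    rw [RFun.fn_faceAt]
    simp [RFun.fn, Q, D, ins1_0, ins1_1, ins1_2]

/-- Auxiliary step `left`: left. [bookkeeping] -/
theorem left : KZ.of (Q.faceAt 1 0 ⟨le_rfl, zero_le_one⟩).rep - KZ.of Ax04.rep ∈ KZ.relations :=
  RFun.rel_of_eqOn fun x _ => by
    rw [RFun.fn_faceAt]
    simp only [RFun.fn, map_add, map_sub, map_mul, map_pow, map_neg, aeval_C, aeval_X, map_one, map_ofNat,
      eq_ratCast, Rat.cast_one, Rat.cast_ofNat, Rat.cast_div, Rat.cast_neg, Rat.cast_zero, ins1_0, ins1_1, ins1_2,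
      ins2_0, ins2_1, ins2_2, Q, D, Ax04, Ax04Den, Nat.cast_ofNat]
    try ring

/-- **Cell C8:** `KZ.of N4.rep - KZ.of C8Bot.rep + KZ.of Ax04.rep ∈ relations`. -/
theorem rel : KZ.of N4.rep - KZ.of C8Bot.rep + KZ.of Ax04.rep ∈ KZ.relations := by
  have e : KZ.of N4.rep - KZ.of C8Bot.rep + KZ.of Ax04.rep =
      (bd 2 P - bd 1 Q) - (KZ.of (P.faceAt 2 1 ⟨zero_le_one, le_rfl⟩).rep - KZ.of N4.rep)
      + (KZ.of (P.faceAt 2 0 ⟨le_rfl, zero_le_one⟩).rep - KZ.of C8Bot.rep)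
      + KZ.of (Q.faceAt 1 1 ⟨zero_le_one, le_rfl⟩).rep
      - (KZ.of (Q.faceAt 1 0 ⟨le_rfl, zero_le_one⟩).rep - KZ.of Ax04.rep) := by
    simp only [bd]; abel
  rw [e]
  exact sub_mem (add_mem (add_mem (sub_mem tel top) bot) right) left

end CellC8

/-! ## §2b Duplication `x ↦ x²` (rule 2 with Jacobian `2x` on the square) -/

section Dup

/-- **The squaring substitution in the first variable.**  If `T(x,y) = S(x²,y)·2x` on `[0,1]²` then
`[T] − [S] ∈ KZ.relations` (`Φ(x,y) = (x²,y)` maps the square onto itself, injectively, with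
Jacobian `2x ≥ 0`). [cite: KontsevichZagier2001, §1.2 rule 2] -/
theorem rel_sq (T S : RFun 2) (h : ∀ z ∈ cube 2, T.fn z = S.fn ![z 0 * z 0, z 1] * (2 * z 0)) :
    KZ.of T.rep - KZ.of S.rep ∈ KZ.relations := by
  let Φ : (Fin 2 → ℝ) → (Fin 2 → ℝ) := fun z => ![z 0 * z 0, z 1]
  let Mz : (Fin 2 → ℝ) → Matrix (Fin 2) (Fin 2) ℝ := fun z => !![2 * z 0, 0; 0, 1]
  let Φ' : (Fin 2 → ℝ) → (Fin 2 → ℝ) →L[ℝ] (Fin 2 → ℝ) := fun z =>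
    LinearMap.toContinuousLinearMap (Matrix.toLin' (Mz z))
  have hΦ'ap : ∀ z w, Φ' z w = ![2 * z 0 * w 0, w 1] := by
    intro z w; funext i
    fin_cases i <;> simp [Φ', Mz, Matrix.toLin'_apply, Matrix.mulVec, dotProduct, Fin.sum_univ_two]
  have hdet : ∀ z, (Φ' z).det = 2 * z 0 := by
    intro z
    unfold ContinuousLinearMap.det
    simp [Φ', LinearMap.det_toLin', Mz, Matrix.det_fin_two]
  have hdom : S.rep.domain = Φ '' T.rep.domain := by
    rw [RFun.rep_domain, RFun.rep_domain]
    ext w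
    constructor
    · intro hw
      refine ⟨![Real.sqrt (w 0), w 1], ?_, ?_⟩
      · intro i
        fin_cases i
        · exact ⟨Real.sqrt_nonneg _, by
            simpa [Real.sqrt_one] using Real.sqrt_le_sqrt (hw 0).2⟩
        · exact hw 1
      · funext i
        fin_cases i
        · simp [Φ, Real.mul_self_sqrt (hw 0).1]
        · simp [Φ]
    · rintro ⟨z, hz, rfl⟩
      intro i
      fin_cases i
      · exact ⟨by simpa [Φ] using mul_nonneg (hz 0).1 (hz 0).1, by
          simpa [Φ] using mul_le_one₀ (hz 0).2 (hz 0).1 (hz 0).2⟩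
      · simpa [Φ] using hz 1
  refine KZ.changeOfVariablesRel_subset_relations ⟨2, T.rep, S.rep, Φ, Φ', ?_, ?_, ?_, hdom, ?_, rfl⟩
  · refine (isSemialgebraicMapOn_iff_forall_holds T.rep.isSemialgebraic_domain).mpr fun i => ?_
    fin_cases i
    · exact (isSemialgebraicFunOn_aeval T.rep.isSemialgebraic_domain (X 0 * X 0)).congr fun z _ => by
        simp [Φ]
    · exact (isSemialgebraicFunOn_aeval T.rep.isSemialgebraic_domain (X 1)).congr fun z _ => by
        simp [Φ]
  · intro z _
    have h0 : HasFDerivAt (fun w : Fin 2 → ℝ => w 0 * w 0)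
        (z 0 • ContinuousLinearMap.proj (R := ℝ) (φ := fun _ : Fin 2 => ℝ) 0 +
          z 0 • ContinuousLinearMap.proj (R := ℝ) (φ := fun _ : Fin 2 => ℝ) 0) z :=
      (hasFDerivAt_apply 0 z).mul (hasFDerivAt_apply 0 z)
    have h1 : HasFDerivAt (fun w : Fin 2 → ℝ => w 1)
        (ContinuousLinearMap.proj (R := ℝ) (φ := fun _ : Fin 2 => ℝ) 1) z := hasFDerivAt_apply 1 z
    have hpi : HasFDerivAt Φ (Φ' z) z := by
      rw [hasFDerivAt_pi']
      intro i
      fin_cases i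
      · have e : (ContinuousLinearMap.proj (R := ℝ) (φ := fun _ : Fin 2 => ℝ) 0).comp (Φ' z) =
            z 0 • ContinuousLinearMap.proj (R := ℝ) (φ := fun _ : Fin 2 => ℝ) 0 +
              z 0 • ContinuousLinearMap.proj (R := ℝ) (φ := fun _ : Fin 2 => ℝ) 0 := by
          ext w; simp [hΦ'ap]; ring
        simpa [e, Φ] using h0
      · have e : (ContinuousLinearMap.proj (R := ℝ) (φ := fun _ : Fin 2 => ℝ) 1).comp (Φ' z) =
            ContinuousLinearMap.proj (R := ℝ) (φ := fun _ : Fin 2 => ℝ) 1 := by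
          ext w; simp [hΦ'ap]
        simpa [e, Φ] using h1
    exact hpi.hasFDerivWithinAt
  · intro z₁ hz₁ z₂ hz₂ heq
    have e0 : z₁ 0 * z₁ 0 = z₂ 0 * z₂ 0 := by simpa [Φ] using congrFun heq 0
    have e1 : z₁ 1 = z₂ 1 := by simpa [Φ] using congrFun heq 1
    have h01 := (hz₁ 0).1
    have h02 := (hz₂ 0).1
    have e0' : z₁ 0 = z₂ 0 := by nlinarith [mul_nonneg h01 h02]
    funext i
    fin_cases i
    · exact e0'
    · exact e1
  · intro z hz
    rw [hdet, RFun.rep_integrand, RFun.rep_integrand, h z hz, abs_of_nonneg (by nlinarith [(hz 0).1])]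

/-- Auxiliary step `vec2_0` (§2b): vec2 0. [bookkeeping] -/
private theorem vec2_0 (a b : ℝ) : (![a, b] : Fin 2 → ℝ) 0 = a := rfl
/-- Auxiliary step `vec2_1` (§2b): vec2 1. [bookkeeping] -/
private theorem vec2_1 (a b : ℝ) : (![a, b] : Fin 2 → ℝ) 1 = b := rfl

/-- pull-back reps and the doubled strips -/
def Sp4 : RFun 2 := ⟨C 2, SpDen, fun _ hx => (SpDen_pos hx).ne'⟩
/-- Auxiliary definition `Sm4n` (§2b): Sm4n. [bookkeeping] -/
def Sm4n : RFun 2 := ⟨-(C 2), SmDen, fun _ hx => (SmDen_pos hx).ne'⟩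
/-- Auxiliary definition `Np2` (§2b): Np2. [bookkeeping] -/
def Np2 : RFun 2 := ⟨C 6, NpDen, fun _ hx => (NpDen_pos hx).ne'⟩
/-- Auxiliary definition `Nm2n` (§2b): Nm2n. [bookkeeping] -/
def Nm2n : RFun 2 := ⟨-(C 6), NmDen, fun _ hx => (NmDen_pos hx).ne'⟩
/-- Auxiliary definition `Ax04q` (§2b): Ax04q. [bookkeeping] -/
def Ax04q : RFun 2 := ⟨C 16 * X 0, Ax04Den, fun _ hx => (Ax04Den_pos hx).ne'⟩
/-- Auxiliary definition `Ax1q` (§2b): Ax1q. [bookkeeping] -/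
def Ax1q : RFun 2 := ⟨C 8 * X 0, Ax1Den, fun _ hx => (Ax1Den_pos hx).ne'⟩

/-- `[Dup1] ≡ [M1]` (`x ↦ x²`). -/
theorem dup1 : KZ.of Dup1.rep - KZ.of M1.rep ∈ KZ.relations :=
  rel_sq Dup1 M1 fun z hz => by
    have hA := (Dup1Den_pos hz).ne'
    simp only [RFun.fn, map_add, map_sub, map_mul, map_pow, map_neg, aeval_C, aeval_X, map_one, map_ofNat,
      eq_ratCast, Rat.cast_one, Rat.cast_ofNat, Rat.cast_div, Rat.cast_neg, Rat.cast_zero, vec2_0, vec2_1, Dup1, M1, Dup1Den, M1Den] at hA ⊢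
    rw [div_mul_eq_mul_div, div_eq_div_iff hA (by
      have := (M1Den_pos (x := ![z 0 * z 0, z 1]) (fun i => by
        fin_cases i
        · exact ⟨by simpa using mul_nonneg (hz 0).1 (hz 0).1, by simpa using mul_le_one₀ (hz 0).2 (hz 0).1 (hz 0).2⟩
        · simpa using hz 1)).ne'
      simpa [map_add, map_sub, map_mul, map_pow, map_neg, aeval_C, aeval_X, map_one, map_ofNat,
      eq_ratCast, Rat.cast_one, Rat.cast_ofNat, Rat.cast_div, Rat.cast_neg, Rat.cast_zero, vec2_0, vec2_1, M1Den] using this)]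
    ring

/-- `[Dup1] ≡ [Sp4] + [Sm4n]` (partial fractions `(1+2x²)² − s²x² = (1+2x²+sx)(1+2x²−sx)`). -/
theorem dup1_split : KZ.of Dup1.rep - KZ.of Sp4.rep - KZ.of Sm4n.rep ∈ KZ.relations :=
  rel_lin Dup1 Sp4 Sm4n fun z hz => by
    have hD := (Dup1Den_pos hz).ne'
    have hA := (SpDen_pos hz).ne'
    have hB := (SmDen_pos hz).ne'
    simp only [RFun.fn, map_add, map_sub, map_mul, map_pow, map_neg, aeval_C, aeval_X, map_one, map_ofNat,
      eq_ratCast, Rat.cast_one, Rat.cast_ofNat, Rat.cast_div, Rat.cast_neg, Rat.cast_zero, Dup1, Sp4, Sm4n, Dup1Den, SpDen, SmDen] at hD hA hB ⊢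
    rw [div_add_div _ _ hA hB, div_eq_div_iff hD (mul_ne_zero hA hB)]
    ring

/-- Auxiliary step `Sp4_rel` (§2b): Sp4 rel. [bookkeeping] -/
theorem Sp4_rel : KZ.of Sp4.rep - 4 • KZ.of Sp.rep ∈ KZ.relations :=
  rel_nsmul 4 Sp4 Sp fun x _ => by
    simp only [RFun.fn, map_add, map_sub, map_mul, map_pow, map_neg, aeval_C, aeval_X, map_one, map_ofNat,
      eq_ratCast, Rat.cast_one, Rat.cast_ofNat, Rat.cast_div, Rat.cast_neg, Rat.cast_zero, Sp4, Sp, SpDen, Nat.cast_ofNat]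
    ring

/-- Auxiliary step `Sm4n_rel` (§2b): Sm4n rel. [bookkeeping] -/
theorem Sm4n_rel : KZ.of Sm4n.rep + 4 • KZ.of Sm.rep ∈ KZ.relations :=
  rel_nsmul_neg 4 Sm4n Sm fun x _ => by
    simp only [RFun.fn, map_add, map_sub, map_mul, map_pow, map_neg, aeval_C, aeval_X, map_one, map_ofNat,
      eq_ratCast, Rat.cast_one, Rat.cast_ofNat, Rat.cast_div, Rat.cast_neg, Rat.cast_zero, Sm4n, Sm, SmDen, Nat.cast_ofNat]
    ring

/-- **Duplication along `H⁺ = (s,2)`:** `[M1] − 4[Sp] + 4[Sm] ∈ relations`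
(`Θ(4−s²,4) − Θ(F4) = 2(Θ(s,2) − Θ(P₀)) + 2(Θ(−s,2) − Θ(P₀))`). -/
theorem d1 : KZ.of M1.rep - 4 • KZ.of Sp.rep + 4 • KZ.of Sm.rep ∈ KZ.relations := by
  have e : KZ.of M1.rep - 4 • KZ.of Sp.rep + 4 • KZ.of Sm.rep =
      -(KZ.of Dup1.rep - KZ.of M1.rep) + (KZ.of Dup1.rep - KZ.of Sp4.rep - KZ.of Sm4n.rep)
      + (KZ.of Sp4.rep - 4 • KZ.of Sp.rep) + (KZ.of Sm4n.rep + 4 • KZ.of Sm.rep) := by abel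
  rw [e]
  exact add_mem (add_mem (add_mem (neg_mem dup1) dup1_split) Sp4_rel) Sm4n_rel

/-- `[Dup2] ≡ [M3]` (`v ↦ v²`). -/
theorem dup2 : KZ.of Dup2.rep - KZ.of M3.rep ∈ KZ.relations :=
  rel_sq Dup2 M3 fun z hz => by
    have hA := (Dup2Den_pos hz).ne'
    simp only [RFun.fn, map_add, map_sub, map_mul, map_pow, map_neg, aeval_C, aeval_X, map_one, map_ofNat,
      eq_ratCast, Rat.cast_one, Rat.cast_ofNat, Rat.cast_div, Rat.cast_neg, Rat.cast_zero, vec2_0, vec2_1, Dup2, M3, Dup2Den, M3Den] at hA ⊢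
    rw [div_mul_eq_mul_div, div_eq_div_iff hA (by
      have := (M3Den_pos (x := ![z 0 * z 0, z 1]) (fun i => by
        fin_cases i
        · exact ⟨by simpa using mul_nonneg (hz 0).1 (hz 0).1, by simpa using mul_le_one₀ (hz 0).2 (hz 0).1 (hz 0).2⟩
        · simpa using hz 1)).ne'
      simpa [map_add, map_sub, map_mul, map_pow, map_neg, aeval_C, aeval_X, map_one, map_ofNat,
      eq_ratCast, Rat.cast_one, Rat.cast_ofNat, Rat.cast_div, Rat.cast_neg, Rat.cast_zero, vec2_0, vec2_1, M3Den] using this)]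
    ring

/-- Auxiliary step `dup2_split` (§2b): dup2 split. [bookkeeping] -/
theorem dup2_split : KZ.of Dup2.rep - KZ.of Np2.rep - KZ.of Nm2n.rep ∈ KZ.relations :=
  rel_lin Dup2 Np2 Nm2n fun z hz => by
    have hD := (Dup2Den_pos hz).ne'
    have hA := (NpDen_pos hz).ne'
    have hB := (NmDen_pos hz).ne'
    simp only [RFun.fn, map_add, map_sub, map_mul, map_pow, map_neg, aeval_C, aeval_X, map_one, map_ofNat,
      eq_ratCast, Rat.cast_one, Rat.cast_ofNat, Rat.cast_div, Rat.cast_neg, Rat.cast_zero, Dup2, Np2, Nm2n, Dup2Den, NpDen, NmDen] at hD hA hB ⊢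
    rw [div_add_div _ _ hA hB, div_eq_div_iff hD (mul_ne_zero hA hB)]
    ring

/-- Auxiliary step `Np2_rel` (§2b): Np2 rel. [bookkeeping] -/
theorem Np2_rel : KZ.of Np2.rep - 2 • KZ.of Np.rep ∈ KZ.relations :=
  rel_nsmul 2 Np2 Np fun x _ => by
    simp only [RFun.fn, map_add, map_sub, map_mul, map_pow, map_neg, aeval_C, aeval_X, map_one, map_ofNat,
      eq_ratCast, Rat.cast_one, Rat.cast_ofNat, Rat.cast_div, Rat.cast_neg, Rat.cast_zero, Np2, Np, NpDen, Nat.cast_ofNat]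
    ring

/-- Auxiliary step `Nm2n_rel` (§2b): Nm2n rel. [bookkeeping] -/
theorem Nm2n_rel : KZ.of Nm2n.rep + 2 • KZ.of Nm.rep ∈ KZ.relations :=
  rel_nsmul_neg 2 Nm2n Nm fun x _ => by
    simp only [RFun.fn, map_add, map_sub, map_mul, map_pow, map_neg, aeval_C, aeval_X, map_one, map_ofNat,
      eq_ratCast, Rat.cast_one, Rat.cast_ofNat, Rat.cast_div, Rat.cast_neg, Rat.cast_zero, Nm2n, Nm, NmDen, Nat.cast_ofNat]
    ring

/-- **Duplication along `γ₂ = (3t,4)`:** `[M3] − 2[Np] + 2[Nm] ∈ relations`. -/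
theorem d2 : KZ.of M3.rep - 2 • KZ.of Np.rep + 2 • KZ.of Nm.rep ∈ KZ.relations := by
  have e : KZ.of M3.rep - 2 • KZ.of Np.rep + 2 • KZ.of Nm.rep =
      -(KZ.of Dup2.rep - KZ.of M3.rep) + (KZ.of Dup2.rep - KZ.of Np2.rep - KZ.of Nm2n.rep)
      + (KZ.of Np2.rep - 2 • KZ.of Np.rep) + (KZ.of Nm2n.rep + 2 • KZ.of Nm.rep) := by abel
  rw [e]
  exact add_mem (add_mem (add_mem (neg_mem dup2) dup2_split) Np2_rel) Nm2n_rel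

/-- `[Ax04q] ≡ [Par4]` (`x ↦ x²`: the parabola `O → F16` is the duplication image of the axis `O → E4`). -/
theorem dup4 : KZ.of Ax04q.rep - KZ.of Par4.rep ∈ KZ.relations :=
  rel_sq Ax04q Par4 fun z hz => by
    simp only [RFun.fn, map_add, map_sub, map_mul, map_pow, map_neg, aeval_C, aeval_X, map_one, map_ofNat,
      eq_ratCast, Rat.cast_one, Rat.cast_ofNat, Rat.cast_div, Rat.cast_neg, Rat.cast_zero, vec2_0, vec2_1, Ax04q, Par4, Ax04Den, Par4Den]
    ring

/-- Auxiliary step `Ax04q_rel` (§2b): Ax04q rel. [bookkeeping] -/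
theorem Ax04q_rel : KZ.of Ax04q.rep - 4 • KZ.of Ax04.rep ∈ KZ.relations :=
  rel_nsmul 4 Ax04q Ax04 fun x _ => by
    simp only [RFun.fn, map_add, map_sub, map_mul, map_pow, map_neg, aeval_C, aeval_X, map_one, map_ofNat,
      eq_ratCast, Rat.cast_one, Rat.cast_ofNat, Rat.cast_div, Rat.cast_neg, Rat.cast_zero, Ax04q, Ax04, Ax04Den, Nat.cast_ofNat]
    ring

/-- **`[Par4] − 4[Ax04] ∈ relations`** (`Θ(F16) = 4Θ(E4)`). -/
theorem p4 : KZ.of Par4.rep - 4 • KZ.of Ax04.rep ∈ KZ.relations := by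
  have e : KZ.of Par4.rep - 4 • KZ.of Ax04.rep =
      -(KZ.of Ax04q.rep - KZ.of Par4.rep) + (KZ.of Ax04q.rep - 4 • KZ.of Ax04.rep) := by abel
  rw [e]
  exact add_mem (neg_mem dup4) Ax04q_rel

/-- `[Ax1q] ≡ [Par2]`. -/
theorem dup2' : KZ.of Ax1q.rep - KZ.of Par2.rep ∈ KZ.relations :=
  rel_sq Ax1q Par2 fun z hz => by
    simp only [RFun.fn, map_add, map_sub, map_mul, map_pow, map_neg, aeval_C, aeval_X, map_one, map_ofNat,
      eq_ratCast, Rat.cast_one, Rat.cast_ofNat, Rat.cast_div, Rat.cast_neg, Rat.cast_zero, vec2_0, vec2_1, Ax1q, Par2, Ax1Den, Par2Den]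
    ring

/-- Auxiliary step `Ax1q_rel` (§2b): Ax1q rel. [bookkeeping] -/
theorem Ax1q_rel : KZ.of Ax1q.rep - 4 • KZ.of Ax1.rep ∈ KZ.relations :=
  rel_nsmul 4 Ax1q Ax1 fun x _ => by
    simp only [RFun.fn, map_add, map_sub, map_mul, map_pow, map_neg, aeval_C, aeval_X, map_one, map_ofNat,
      eq_ratCast, Rat.cast_one, Rat.cast_ofNat, Rat.cast_div, Rat.cast_neg, Rat.cast_zero, Ax1q, Ax1, Ax1Den, Nat.cast_ofNat]
    ring

/-- **`[Par2] − 4[Ax1] ∈ relations`** (`Θ(F4) = 4Θ(P₀)`). -/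
theorem p2 : KZ.of Par2.rep - 4 • KZ.of Ax1.rep ∈ KZ.relations := by
  have e : KZ.of Par2.rep - 4 • KZ.of Ax1.rep =
      -(KZ.of Ax1q.rep - KZ.of Par2.rep) + (KZ.of Ax1q.rep - 4 • KZ.of Ax1.rep) := by abel
  rw [e]
  exact add_mem (neg_mem dup2') Ax1q_rel

end Dup

/-! ## §2c Inversion `x ↦ 1/x` as: dyadic subdivision + the Möbius self-map `x ↦ 2x/(1+x)` of the square -/

section Inv

/-- Dyadic subdivision of the square along the coordinate `i` (rules 1+2).
[cite: KontsevichZagier2001, §1.2 rules 1, 2] -/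
private theorem rel_subdiv (i : Fin 2) (T T₁ T₂ : RFun 2)
    (h₁ : ∀ x ∈ cube 2, T₁.fn x = (1 / 2 : ℝ) * T.fn (Function.update x i (x i / 2)))
    (h₂ : ∀ x ∈ cube 2, T₂.fn x = (1 / 2 : ℝ) * T.fn (Function.update x i ((1 + x i) / 2))) :
    KZ.of T.rep - KZ.of T₁.rep - KZ.of T₂.rep ∈ KZ.relations :=
  KZ.cubicalSubdivGens_subset_relations ⟨2, T.rep, T₁.rep, T₂.rep, i, rfl, T.analyticOnNhd_fn, rfl,
    T₁.analyticOnNhd_fn, rfl, T₂.analyticOnNhd_fn, h₁, h₂, rfl⟩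

end Inv
end Summit.KontsevichZagierPeriods.RootDecompQuadraticDescent.Pair18Homotopy
end
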